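import Summits.Schanuel.Schanuel.Theorems.ZilberEacParamCurveDensity
import Summits.Schanuel.Schanuel.Theorems.ZilberEacRealLineEdgeTools
import HarnessLib

/-!
# Polynomially parametrised base curves, VII: the surfaces `C × Z(P)` lie in Mantova–Masser's
# case (dim-π-S-1-free); case ∧ dense

HONEST FRAMING.  Cell `pub-schanuel` (Zilber's Exponential-Algebraic Closedness, case ladder;
host summit Schanuel), seat 2, gen 19.  Case certificate and examples for the density theorems of
`ZilberEacParamCurveDensity` (Mantova–Masser's OPEN density question, PLMS 2024 §1 p. 5, on the
product surfaces over a polynomial curve `C = g(ℂ)`).  NOT Schanuel's conjecture (neither used nor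
implied; EAC ⇏ SC); `EC(3,2)` stays OPEN; the question stays OPEN in general.

* Part A: `π(S ∩ G²) = C` (given a torus point of `Z(P)`), `I(C) = ker(x ↦ g)`,
  `dim C = dim ℂ[t] = 1` (`ℂ[t]` is integral over `ℂ[g₀, g₁]`), and `C` is not a line of rational
  slope as soon as no relation `m₀ g₀ + m₁ g₁ = c` (`m ∈ ℤ² ∖ 0`) holds — automatic for
  `1 ≤ deg g₀ ≠ deg g₁` and for equal degrees with non-real leading ratio.
* Part B: `mmCase_paramSurface` and **case ∧ dense** (`unprojectedDensityQuestion_instance_…`).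
Examples (cusp, node, non-real equal degrees) and the `EC(3,2)` corollary: file VIII,
`ZilberEacParamCurveExamples`.
-/

noncomputable section

open Complex MvPolynomial
open Literature.NumberTheory.Transcendental Literature.ModelTheory.Zilber
open Literature.ModelTheory.ExponentialFields

set_option linter.dupNamespace false

namespace Summit.Schanuel.Schanuel.Theorems

section Case

variable (g₀ g₁ : Polynomial ℂ) {P : MvPolynomial (Fin 2) ℂ}

/-! ## Part A. The base curve `C = g(ℂ)` -/

/-- Torus points of `S(g; P)` ↔ torus zeros of `P`. -/
theorem paramSurface_inter_torusLocus_nonempty_iff (P : MvPolynomial (Fin 2) ℂ) :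
    ({w : Fin 2 ⊕ Fin 2 → ℂ | ∃ t : ℂ, w (Sum.inl 0) = g₀.eval t ∧ w (Sum.inl 1) = g₁.eval t ∧
        MvPolynomial.eval (fun i => w (Sum.inr i)) P = 0} ∩ torusLocus ℂ 2).Nonempty ↔
      ∃ c : Fin 2 → ℂ, c 0 ≠ 0 ∧ c 1 ≠ 0 ∧ MvPolynomial.eval c P = 0 := by
  constructor
  · rintro ⟨w, ⟨t, -, -, hwP⟩, hwT⟩
    exact ⟨fun i => w (Sum.inr i), hwT 0, hwT 1, hwP⟩
  · rintro ⟨c, h0, h1, hc⟩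
    refine ⟨Sum.elim ![g₀.eval 0, g₁.eval 0] c, ⟨0, by simp, by simp, ?_⟩, fun i => ?_⟩
    · simpa using hc
    · fin_cases i
      · simpa using h0
      · simpa using h1

/-- **`π(S(g; P) ∩ G²) = C = g(ℂ)`** as soon as `Z(P)` has a torus point. (new) -/
theorem projAdd_image_paramSurface_inter_torusLocus {c : Fin 2 → ℂ} (h0 : c 0 ≠ 0) (h1 : c 1 ≠ 0)
    (hc : MvPolynomial.eval c P = 0) :
    projAdd '' ({w : Fin 2 ⊕ Fin 2 → ℂ | ∃ t : ℂ, w (Sum.inl 0) = g₀.eval t ∧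
        w (Sum.inl 1) = g₁.eval t ∧ MvPolynomial.eval (fun i => w (Sum.inr i)) P = 0} ∩
        torusLocus ℂ 2) =
      {x : Fin 2 → ℂ | ∃ t : ℂ, x 0 = g₀.eval t ∧ x 1 = g₁.eval t} := by
  ext x
  simp only [Set.mem_image, Set.mem_inter_iff, Set.mem_setOf_eq, mem_torusLocus_iff]
  constructor
  · rintro ⟨w, ⟨⟨t, hw0, hw1, -⟩, -⟩, rfl⟩
    exact ⟨t, by simpa using hw0, by simpa using hw1⟩
  · rintro ⟨t, hx0, hx1⟩
    refine ⟨Sum.elim x c, ⟨⟨t, by simpa using hx0, by simpa using hx1, by simpa using hc⟩,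
      fun i => ?_⟩, ?_⟩
    · fin_cases i
      · simpa using h0
      · simpa using h1
    · funext i; simp

/-- Evaluating `f(g₀, g₁) ∈ ℂ[t]` at `t` is evaluating `f` at `g(t)`. -/
theorem eval_aeval_pair (f : MvPolynomial (Fin 2) ℂ) (t : ℂ) :
    (aeval (![g₀, g₁] : Fin 2 → Polynomial ℂ) f).eval t = MvPolynomial.eval ![g₀.eval t, g₁.eval t] f := by
  have e : (fun i => Polynomial.aeval t ((![g₀, g₁] : Fin 2 → Polynomial ℂ) i)) =
      ![g₀.eval t, g₁.eval t] := by
    funext i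
    fin_cases i <;> simp [Polynomial.coe_aeval_eq_eval]
  calc (aeval (![g₀, g₁] : Fin 2 → Polynomial ℂ) f).eval t
      = Polynomial.aeval t (aeval (![g₀, g₁] : Fin 2 → Polynomial ℂ) f) := by
        rw [Polynomial.coe_aeval_eq_eval]
    _ = ((Polynomial.aeval t).comp (aeval (![g₀, g₁] : Fin 2 → Polynomial ℂ))) f := rfl
    _ = aeval (fun i => Polynomial.aeval t ((![g₀, g₁] : Fin 2 → Polynomial ℂ) i)) f := by
        rw [MvPolynomial.comp_aeval]
    _ = MvPolynomial.eval ![g₀.eval t, g₁.eval t] f := by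
        rw [e]; rfl

/-- **`I(C) = ker(ℂ[x₀, x₁] → ℂ[t], xᵢ ↦ gᵢ)`** (a polynomial vanishing at `g(t)` for all `t` is
zero in `ℂ[t]`). (new) -/
theorem vanishingIdeal_paramCurve :
    vanishingIdeal ℂ {x : Fin 2 → ℂ | ∃ t : ℂ, x 0 = g₀.eval t ∧ x 1 = g₁.eval t} =
      RingHom.ker (aeval (![g₀, g₁] : Fin 2 → Polynomial ℂ) :
        MvPolynomial (Fin 2) ℂ →ₐ[ℂ] Polynomial ℂ).toRingHom := by
  ext f
  rw [mem_vanishingIdeal_iff, RingHom.mem_ker]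
  change _ ↔ aeval (![g₀, g₁] : Fin 2 → Polynomial ℂ) f = 0
  constructor
  · intro h
    apply Polynomial.eq_zero_of_infinite_isRoot
    have hall : {x : ℂ | Polynomial.IsRoot ((aeval (![g₀, g₁] : Fin 2 → Polynomial ℂ) f)) x} =
        Set.univ := by
      ext t
      simp only [Set.mem_setOf_eq, Set.mem_univ, iff_true, Polynomial.IsRoot]
      rw [eval_aeval_pair]
      exact h ![g₀.eval t, g₁.eval t] ⟨t, by simp, by simp⟩
    rw [hall]; exact Set.infinite_univ
  · rintro h x ⟨t, hx0, hx1⟩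
    have hx : x = ![g₀.eval t, g₁.eval t] := by
      funext i; fin_cases i
      · simpa using hx0
      · simpa using hx1
    rw [hx]
    change MvPolynomial.eval ![g₀.eval t, g₁.eval t] f = 0
    rw [← eval_aeval_pair, h, Polynomial.eval_zero]

/-- **`ℂ[t]` is integral over `ℂ[x₀, x₁]` through `xᵢ ↦ gᵢ`** (`deg g₀ ≥ 1`). (new) -/
theorem isIntegral_aeval_pair (hg₀ : 1 ≤ g₀.natDegree) :
    (aeval (![g₀, g₁] : Fin 2 → Polynomial ℂ) :
        MvPolynomial (Fin 2) ℂ →ₐ[ℂ] Polynomial ℂ).toRingHom.IsIntegral := by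
  set f : MvPolynomial (Fin 2) ℂ →+* Polynomial ℂ :=
    (aeval (![g₀, g₁] : Fin 2 → Polynomial ℂ) : MvPolynomial (Fin 2) ℂ →ₐ[ℂ] Polynomial ℂ).toRingHom
    with hf
  have hfapply : ∀ r, f r = aeval (![g₀, g₁] : Fin 2 → Polynomial ℂ) r := fun r => rfl
  have hC : ∀ c : ℂ, f.IsIntegralElem (Polynomial.C c) := by
    intro c
    have : Polynomial.C c = f (MvPolynomial.C c) := by rw [hfapply, MvPolynomial.algHom_C]; rfl
    rw [this]; exact f.isIntegralElem_map
  have hT : f.IsIntegralElem (Polynomial.X : Polynomial ℂ) := by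
    have hg0 : g₀ ≠ 0 := by
      rintro rfl
      rw [Polynomial.natDegree_zero] at hg₀; omega
    set u : ℂ := g₀.leadingCoeff with hu
    have hu0 : u ≠ 0 := Polynomial.leadingCoeff_ne_zero.2 hg0
    set gR : Polynomial (MvPolynomial (Fin 2) ℂ) :=
      g₀.map (MvPolynomial.C : ℂ →+* MvPolynomial (Fin 2) ℂ) with hgR
    have hCinj : Function.Injective (MvPolynomial.C : ℂ →+* MvPolynomial (Fin 2) ℂ) :=
      MvPolynomial.C_injective _ _
    have hgRdeg : gR.degree = g₀.degree := Polynomial.degree_map_eq_of_injective hCinj _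
    have hgRlc : gR.leadingCoeff = MvPolynomial.C u := by
      rw [hgR, Polynomial.leadingCoeff_map_of_injective hCinj, hu]
    have hdeglt : (Polynomial.C (X 0 : MvPolynomial (Fin 2) ℂ)).degree < gR.degree := by
      rw [hgRdeg]
      calc (Polynomial.C (X 0 : MvPolynomial (Fin 2) ℂ)).degree ≤ 0 := Polynomial.degree_C_le
        _ < g₀.degree := by
            rw [Polynomial.degree_eq_natDegree hg0]; exact_mod_cast hg₀
    set q : Polynomial (MvPolynomial (Fin 2) ℂ) :=
      Polynomial.C (MvPolynomial.C u⁻¹) * (gR - Polynomial.C (X 0)) with hq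
    have hqmonic : q.Monic := by
      apply Polynomial.monic_C_mul_of_mul_leadingCoeff_eq_one
      rw [Polynomial.leadingCoeff_sub_of_degree_lt hdeglt, hgRlc, ← map_mul, inv_mul_cancel₀ hu0,
        MvPolynomial.C_1]
    refine ⟨q, hqmonic, ?_⟩
    have hfC : f.comp MvPolynomial.C = Polynomial.C :=
      RingHom.ext fun c => by
        simp only [RingHom.comp_apply, hfapply, MvPolynomial.algHom_C, Polynomial.algebraMap_eq]
    have heval : Polynomial.eval₂ f Polynomial.X gR = f (X 0) := by
      rw [hgR, Polynomial.eval₂_map, hfC, Polynomial.eval₂_C_X, hfapply, MvPolynomial.aeval_X]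
      simp
    rw [hq, Polynomial.eval₂_mul, Polynomial.eval₂_C, Polynomial.eval₂_sub, Polynomial.eval₂_C, heval,
      sub_self, mul_zero]
  intro b
  induction b using Polynomial.induction_on' with
  | add p q hp hq => exact hp.add f hq
  | monomial n c =>
    rw [← Polynomial.C_mul_X_pow_eq_monomial]
    refine (hC c).mul f ?_
    induction n with
    | zero => rw [pow_zero]; exact hC 1 |>.of_mem_closure f (hC 1) (by simp)
    | succ k ih => rw [pow_succ]; exact ih.mul f hT

/-- **`dim C = 1`**: `ℂ[x]/I(C) ≅ ℂ[g₀, g₁] ⊆ ℂ[t]` is an integral extension. (new) -/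
theorem zariskiDim_paramCurve (hg₀ : 1 ≤ g₀.natDegree) :
    zariskiDim ℂ {x : Fin 2 → ℂ | ∃ t : ℂ, x 0 = g₀.eval t ∧ x 1 = g₁.eval t} = (1 : ℕ) := by
  unfold zariskiDim
  rw [vanishingIdeal_paramCurve]
  set f : MvPolynomial (Fin 2) ℂ →+* Polynomial ℂ :=
    (aeval (![g₀, g₁] : Fin 2 → Polynomial ℂ) : MvPolynomial (Fin 2) ℂ →ₐ[ℂ] Polynomial ℂ).toRingHom
    with hf
  have hfint : f.IsIntegral := isIntegral_aeval_pair g₀ g₁ hg₀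
  letI : Algebra (MvPolynomial (Fin 2) ℂ ⧸ RingHom.ker f) (Polynomial ℂ) := (RingHom.kerLift f).toAlgebra
  haveI : Algebra.IsIntegral (MvPolynomial (Fin 2) ℂ ⧸ RingHom.ker f) (Polynomial ℂ) := by
    refine ⟨fun b => ?_⟩
    obtain ⟨p, hp, hpb⟩ := hfint b
    refine ⟨p.map (Ideal.Quotient.mk (RingHom.ker f)), hp.map _, ?_⟩
    rw [Polynomial.eval₂_map]
    have hcomp : (algebraMap (MvPolynomial (Fin 2) ℂ ⧸ RingHom.ker f) (Polynomial ℂ)).comp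
        (Ideal.Quotient.mk (RingHom.ker f)) = f := by
      ext r <;> simp [RingHom.algebraMap_toAlgebra]
    rw [hcomp]; exact hpb
  rw [Literature.RingTheory.KrullDimension.ringKrullDim_eq_of_isIntegral
    (R := MvPolynomial (Fin 2) ℂ ⧸ RingHom.ker f) (S := Polynomial ℂ) (RingHom.kerLift_injective f),
    Polynomial.ringKrullDim_of_isNoetherianRing, ringKrullDim_eq_zero_of_field, zero_add]
  rfl

/-- **`C` is not a line of rational slope** when no relation `m₀ g₀ + m₁ g₁ = c` with
`m ∈ ℤ² ∖ {0}` holds in `ℂ[t]`. (new) -/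
theorem not_isRationalSlopeLine_paramCurve
    (hindep : ∀ m : Fin 2 → ℤ, m ≠ 0 → ∀ c : ℂ,
      Polynomial.C (m 0 : ℂ) * g₀ + Polynomial.C (m 1 : ℂ) * g₁ ≠ Polynomial.C c) :
    ¬ IsRationalSlopeLine (zeroLocus ℂ (vanishingIdeal ℂ
      {x : Fin 2 → ℂ | ∃ t : ℂ, x 0 = g₀.eval t ∧ x 1 = g₁.eval t})) := by
  rintro ⟨m, hm, c, hL⟩
  apply hindep m hm c
  apply Polynomial.funext
  intro t
  have hxZ : (![g₀.eval t, g₁.eval t] : Fin 2 → ℂ) ∈ zeroLocus ℂ (vanishingIdeal ℂ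
      {x : Fin 2 → ℂ | ∃ t : ℂ, x 0 = g₀.eval t ∧ x 1 = g₁.eval t}) := by
    rw [mem_zeroLocus_iff]
    intro p hp
    exact (mem_vanishingIdeal_iff.mp hp) _ ⟨t, by simp, by simp⟩
  rw [hL] at hxZ
  simp only [Set.mem_setOf_eq, Matrix.cons_val_zero, Matrix.cons_val_one,
    Matrix.cons_val_fin_one] at hxZ
  simp [hxZ]

/-- **Independence, unequal degrees** `1 ≤ deg g₀`, `deg g₀ ≠ deg g₁`, `1 ≤ deg g₁`. (new) -/
theorem paramCurve_indep_of_ne (hg₀ : 1 ≤ g₀.natDegree) (hg₁ : 1 ≤ g₁.natDegree)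
    (hne : g₀.natDegree ≠ g₁.natDegree) (m : Fin 2 → ℤ) (hm : m ≠ 0) (c : ℂ) :
    Polynomial.C (m 0 : ℂ) * g₀ + Polynomial.C (m 1 : ℂ) * g₁ ≠ Polynomial.C c := by
  intro h
  -- wlog by symmetry of the statement we treat both orders
  have key : ∀ (a b : Polynomial ℂ) (k l : ℤ), 1 ≤ a.natDegree → a.natDegree < b.natDegree →
      Polynomial.C (k : ℂ) * a + Polynomial.C (l : ℂ) * b = Polynomial.C c → k = 0 ∧ l = 0 := by
    intro a b k l ha hab hh
    have hb0 : b ≠ 0 := by rintro rfl; rw [Polynomial.natDegree_zero] at hab; omega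
    have ha0 : a ≠ 0 := by rintro rfl; rw [Polynomial.natDegree_zero] at ha; omega
    -- coefficient of `t^{deg b}`
    have h1 := congrArg (fun q => q.coeff b.natDegree) hh
    simp only [Polynomial.coeff_add, Polynomial.coeff_C_mul, Polynomial.coeff_C,
      Polynomial.coeff_natDegree] at h1
    rw [Polynomial.coeff_eq_zero_of_natDegree_lt hab, if_neg (by omega)] at h1
    have hl : (l : ℂ) = 0 := by
      have := Polynomial.leadingCoeff_ne_zero.2 hb0
      simpa [this] using h1
    have hl' : l = 0 := by exact_mod_cast hl
    -- then coefficient of `t^{deg a}`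
    rw [hl, Polynomial.C_0, zero_mul, add_zero] at hh
    have h2 := congrArg (fun q => q.coeff a.natDegree) hh
    simp only [Polynomial.coeff_C_mul, Polynomial.coeff_C, Polynomial.coeff_natDegree] at h2
    rw [if_neg (by omega)] at h2
    have hk : (k : ℂ) = 0 := by
      have := Polynomial.leadingCoeff_ne_zero.2 ha0
      simpa [this] using h2
    exact ⟨by exact_mod_cast hk, hl'⟩
  rcases Nat.lt_or_gt_of_ne hne with hlt | hgt
  · obtain ⟨h0, h1⟩ := key g₀ g₁ (m 0) (m 1) hg₀ hlt h
    exact hm (funext fun i => by fin_cases i <;> assumption)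
  · obtain ⟨h1, h0⟩ := key g₁ g₀ (m 1) (m 0) hg₁ hgt (by rw [← h]; ring)
    exact hm (funext fun i => by fin_cases i <;> assumption)

/-- **Independence, equal degrees with non-real leading ratio.** (new) -/
theorem paramCurve_indep_of_im_ne_zero (hg₀ : 1 ≤ g₀.natDegree) (heq : g₁.natDegree = g₀.natDegree)
    (him : (g₁.leadingCoeff / g₀.leadingCoeff).im ≠ 0) (m : Fin 2 → ℤ) (hm : m ≠ 0) (c : ℂ) :
    Polynomial.C (m 0 : ℂ) * g₀ + Polynomial.C (m 1 : ℂ) * g₁ ≠ Polynomial.C c := by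
  intro h
  have hg0 : g₀ ≠ 0 := by rintro rfl; rw [Polynomial.natDegree_zero] at hg₀; omega
  have hlc0 : g₀.leadingCoeff ≠ 0 := Polynomial.leadingCoeff_ne_zero.2 hg0
  have h1 := congrArg (fun q => q.coeff g₀.natDegree) h
  simp only [Polynomial.coeff_add, Polynomial.coeff_C_mul, Polynomial.coeff_C,
    Polynomial.coeff_natDegree] at h1
  -- `m₀ lc₀ + m₁ lc₁ = 0`
  have hdeg0 : g₀.natDegree ≠ 0 := by omega
  have hco : g₁.coeff g₀.natDegree = g₁.leadingCoeff := by rw [← heq]; rfl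
  rw [if_neg hdeg0, hco] at h1
  by_cases hm1 : m 1 = 0
  · have hm0 : (m 0 : ℂ) = 0 := by
      rw [hm1] at h1; push_cast at h1
      simpa [hlc0] using h1
    apply hm
    funext i; fin_cases i
    · exact_mod_cast hm0
    · exact hm1
  · apply him
    have hm1C : (m 1 : ℂ) ≠ 0 := by exact_mod_cast hm1
    have hratio : g₁.leadingCoeff / g₀.leadingCoeff = -((m 0 : ℂ) / (m 1 : ℂ)) := by
      field_simp
      linear_combination h1
    rw [hratio]
    simp [Complex.div_im, Complex.neg_im]

/-! ## Part B. The case certificate; case ∧ dense -/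

/-- **`dim cl π(S ∩ G²) = 1`** (given a torus zero of `P`, `deg g₀ ≥ 1`). (new) -/
theorem addProjDim_paramSurface (hg₀ : 1 ≤ g₀.natDegree) {c : Fin 2 → ℂ} (h0 : c 0 ≠ 0)
    (h1 : c 1 ≠ 0) (hc : MvPolynomial.eval c P = 0) :
    addProjDim ℂ 2 {w : Fin 2 ⊕ Fin 2 → ℂ | ∃ t : ℂ, w (Sum.inl 0) = g₀.eval t ∧
        w (Sum.inl 1) = g₁.eval t ∧ MvPolynomial.eval (fun i => w (Sum.inr i)) P = 0} = (1 : ℕ) := by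
  unfold addProjDim
  rw [projAdd_image_paramSurface_inter_torusLocus g₀ g₁ h0 h1 hc]
  exact zariskiDim_paramCurve g₀ g₁ hg₀

/-- **Case certificate.**  `deg g₀ ≥ 1`, no relation `m₀ g₀ + m₁ g₁ = c` (`m ∈ ℤ² ∖ 0`), `P`
irreducible with a torus zero: `S(g; P)` satisfies the hypotheses of Mantova–Masser's case
(dim-π-S-1-free). (new) -/
theorem mmCase_paramSurface (hg₀ : 1 ≤ g₀.natDegree)
    (hindep : ∀ m : Fin 2 → ℤ, m ≠ 0 → ∀ c : ℂ,
      Polynomial.C (m 0 : ℂ) * g₀ + Polynomial.C (m 1 : ℂ) * g₁ ≠ Polynomial.C c)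
    (hirr : Irreducible P) {c : Fin 2 → ℂ} (h0 : c 0 ≠ 0) (h1 : c 1 ≠ 0)
    (hc : MvPolynomial.eval c P = 0) :
    MMCaseDimPiOneFree {w : Fin 2 ⊕ Fin 2 → ℂ | ∃ t : ℂ, w (Sum.inl 0) = g₀.eval t ∧
        w (Sum.inl 1) = g₁.eval t ∧ MvPolynomial.eval (fun i => w (Sum.inr i)) P = 0} := by
  refine ⟨isIrreducibleClosed_paramSurface g₀ g₁ hg₀ hirr,
    (paramSurface_inter_torusLocus_nonempty_iff g₀ g₁ P).2 ⟨c, h0, h1, hc⟩,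
    zariskiDim_paramSurface g₀ g₁ hg₀ hirr, addProjDim_paramSurface g₀ g₁ hg₀ h0 h1 hc, ?_⟩
  rw [projAdd_image_paramSurface_inter_torusLocus g₀ g₁ h0 h1 hc]
  exact not_isRationalSlopeLine_paramCurve g₀ g₁ hindep

/-- **Mantova–Masser's question on the family: case ∧ dense (unequal degrees).**
`1 ≤ deg g₀ < deg g₁`, `P` irreducible with two monomials of different `y₁`-degree: `S(g; P)` is
in case (dim-π-S-1-free) AND its exponential points are Zariski dense (a torus zero of `P` is
automatic: `exists_torus_zero_of_ne`).
[cite: MantovaMasser2023, §1 Further remarks, p. 5 (the question, open in general)] (new) -/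
theorem unprojectedDensityQuestion_instance_paramSurface_of_lt (hg₀ : 1 ≤ g₀.natDegree)
    (hlt : g₀.natDegree < g₁.natDegree) (hirr : Irreducible P)
    (h2 : ∃ v ∈ P.support, ∃ v' ∈ P.support, v 1 ≠ v' 1) :
    MMCaseDimPiOneFree {w : Fin 2 ⊕ Fin 2 → ℂ | ∃ t : ℂ, w (Sum.inl 0) = g₀.eval t ∧
        w (Sum.inl 1) = g₁.eval t ∧ MvPolynomial.eval (fun i => w (Sum.inr i)) P = 0} ∧
      UnprojectedDense {w : Fin 2 ⊕ Fin 2 → ℂ | ∃ t : ℂ, w (Sum.inl 0) = g₀.eval t ∧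
        w (Sum.inl 1) = g₁.eval t ∧ MvPolynomial.eval (fun i => w (Sum.inr i)) P = 0} := by
  obtain ⟨v, hv, v', hv', hne⟩ := h2
  obtain ⟨c, h0, h1, hc⟩ := exists_torus_zero_of_ne (R := P) ⟨v, hv, v', hv', fun h => hne (by rw [h])⟩
  exact ⟨mmCase_paramSurface g₀ g₁ hg₀
      (paramCurve_indep_of_ne g₀ g₁ hg₀ (by omega) (by omega)) hirr h0 h1 hc,
    unprojectedDense_paramSurface_of_lt g₀ g₁ hg₀ hlt hirr ⟨v, hv, v', hv', hne⟩⟩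

/-- **Case ∧ dense (mirror, `1 ≤ deg g₁ < deg g₀`)**, `P` irreducible with two monomials of
different `y₀`-degree. [cite: MantovaMasser2023, §1 Further remarks, p. 5] (new) -/
theorem unprojectedDensityQuestion_instance_paramSurface_of_gt (hg₁ : 1 ≤ g₁.natDegree)
    (hlt : g₁.natDegree < g₀.natDegree) (hirr : Irreducible P)
    (h2 : ∃ v ∈ P.support, ∃ v' ∈ P.support, v 0 ≠ v' 0) :
    MMCaseDimPiOneFree {w : Fin 2 ⊕ Fin 2 → ℂ | ∃ t : ℂ, w (Sum.inl 0) = g₀.eval t ∧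
        w (Sum.inl 1) = g₁.eval t ∧ MvPolynomial.eval (fun i => w (Sum.inr i)) P = 0} ∧
      UnprojectedDense {w : Fin 2 ⊕ Fin 2 → ℂ | ∃ t : ℂ, w (Sum.inl 0) = g₀.eval t ∧
        w (Sum.inl 1) = g₁.eval t ∧ MvPolynomial.eval (fun i => w (Sum.inr i)) P = 0} := by
  obtain ⟨v, hv, v', hv', hne⟩ := h2
  obtain ⟨c, h0, h1, hc⟩ := exists_torus_zero_of_ne (R := P) ⟨v, hv, v', hv', fun h => hne (by rw [h])⟩
  exact ⟨mmCase_paramSurface g₀ g₁ (by omega)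
      (paramCurve_indep_of_ne g₀ g₁ (by omega) hg₁ (by omega)) hirr h0 h1 hc,
    unprojectedDense_paramSurface_of_gt g₀ g₁ hg₁ hlt hirr ⟨v, hv, v', hv', hne⟩⟩

/-- **Case ∧ dense (equal degrees, non-real leading ratio)**, `P` irreducible, not a monomial.
[cite: MantovaMasser2023, §1 Further remarks, p. 5] (new) -/
theorem unprojectedDensityQuestion_instance_paramSurface_of_eq (hd : 2 ≤ g₀.natDegree)
    (heq : g₁.natDegree = g₀.natDegree) (him : (g₁.leadingCoeff / g₀.leadingCoeff).im ≠ 0)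
    (hirr : Irreducible P) (h2 : ∃ v ∈ P.support, ∃ v' ∈ P.support, v ≠ v') :
    MMCaseDimPiOneFree {w : Fin 2 ⊕ Fin 2 → ℂ | ∃ t : ℂ, w (Sum.inl 0) = g₀.eval t ∧
        w (Sum.inl 1) = g₁.eval t ∧ MvPolynomial.eval (fun i => w (Sum.inr i)) P = 0} ∧
      UnprojectedDense {w : Fin 2 ⊕ Fin 2 → ℂ | ∃ t : ℂ, w (Sum.inl 0) = g₀.eval t ∧
        w (Sum.inl 1) = g₁.eval t ∧ MvPolynomial.eval (fun i => w (Sum.inr i)) P = 0} := by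
  obtain ⟨c, h0, h1, hc⟩ := exists_torus_zero_of_ne (R := P) h2
  exact ⟨mmCase_paramSurface g₀ g₁ (by omega)
      (paramCurve_indep_of_im_ne_zero g₀ g₁ (by omega) heq him) hirr h0 h1 hc,
    unprojectedDense_paramSurface_of_eq_all g₀ g₁ hd heq him hirr h2⟩

end Case

end Summit.Schanuel.Schanuel.Theorems
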